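import Mathlib
import Literature.Computability.AlgebraicComplexity.PrattTrapezoidVal
import Literature.Computability.AlgebraicComplexity.LocalStrongUSP
import Summits.MatrixMultiplication.MatrixMultiplication.Theorems.SoloBlindPrattValCyclic

/-!
# A local strong USP of width 9 and size 11: `Val(ℤ/nℤ) ≥ 10 n` for nine coprime moduli `≥ 128`

Solo-blind line Q12 (Pratt, arXiv:2309.03878), seventh file.  SAT search (kissat, this seat's
`lsusp_sat.py`) for local strong USPs (CKSU 2005 §6.1) found sizes `≥ 10` and then `≥ 11` at width `9`
(per-coordinate rate `11^{1/9} ≈ 1.305`, the best explicit block this seat has; widths `≤ 7` are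
settled: `1,1,2,2,3,4,6`, width `8` has `≥ 8`).  Kernel-verified here by `decide`, with the cyclic
corollaries `11 · ∏ⱼ (mⱼ − 1) ≤ Val(ℤ/nℤ)` for nine pairwise coprime moduli and `Val(ℤ/nℤ) ≥ 10 n` when
all nine moduli are `≥ 128` (`11 · (127/128)^9 > 10`), and `Val(K⁹) ≥ 11 (|K| − 1)⁹` for every finite
abelian group `K`.
-/

set_option linter.dupNamespace false
set_option maxRecDepth 4000

namespace Summit.MatrixMultiplication.MatrixMultiplication.Theorems

open Finset Literature.Computability.AlgebraicComplexity

/-- The width-9 local strong USP of size 11 found by SAT search (symbols `1,2,3` coded `0,1,2`):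
`333222111, 331322211, 313232121, 311233221, 311132223, 233321211, 231121123, 213332211, 213223113, 211233213, 113322123`. -/
theorem soloVal_isLocalStrongUSP_width9 :
    IsLocalStrongUSP
      ![![(2 : Fin 3), 2, 2, 1, 1, 1, 0, 0, 0],
      ![(2 : Fin 3), 2, 0, 2, 1, 1, 1, 0, 0],
      ![(2 : Fin 3), 0, 2, 1, 2, 1, 0, 1, 0],
      ![(2 : Fin 3), 0, 0, 1, 2, 2, 1, 1, 0],
      ![(2 : Fin 3), 0, 0, 0, 2, 1, 1, 1, 2],
      ![(1 : Fin 3), 2, 2, 2, 1, 0, 1, 0, 0],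
      ![(1 : Fin 3), 2, 0, 0, 1, 0, 0, 1, 2],
      ![(1 : Fin 3), 0, 2, 2, 2, 1, 1, 0, 0],
      ![(1 : Fin 3), 0, 2, 1, 1, 2, 0, 0, 2],
      ![(1 : Fin 3), 0, 0, 1, 2, 2, 1, 0, 2],
      ![(0 : Fin 3), 0, 2, 2, 1, 1, 0, 1, 2]] := by
  unfold IsLocalStrongUSP localStrongUSPPatterns
  decide

/-- **Nine-modulus block.**  For pairwise coprime moduli `m₀, …, m₈ ≥ 1` with product `n`:
`11 · ∏ⱼ (mⱼ − 1) ≤ Val(ℤ/nℤ)`. -/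
theorem soloVal_nineBlock (m : Fin 9 → ℕ) (hm0 : ∀ j, m j ≠ 0)
    (hm : Pairwise (Function.onFun Nat.Coprime m)) (n : ℕ) [NeZero n] (hn : n = ∏ j, m j) :
    11 * ∏ j, (m j - 1) ≤ prattVal (ZMod n) :=
  soloVal_le_prattVal_zmod_of_isLocalStrongUSP soloVal_isLocalStrongUSP_width9 m hm0 hm n hn

/-- **Nine coprime moduli `≥ 128` give `Val(ℤ/nℤ) ≥ 10 n`** (`11 · (127/128)^9 > 10`). -/
theorem soloVal_nineBlock_ge128 (m : Fin 9 → ℕ) (h128 : ∀ j, 128 ≤ m j)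
    (hm : Pairwise (Function.onFun Nat.Coprime m)) (n : ℕ) [NeZero n] (hn : n = ∏ j, m j) :
    10 * n ≤ prattVal (ZMod n) := by
  have h := soloVal_nineBlock m (fun j => by have := h128 j; omega) hm n hn
  have hprod : ∏ j, (127 * m j) ≤ ∏ j, (128 * (m j - 1)) :=
    Finset.prod_le_prod' fun j _ => by have := h128 j; omega
  rw [Finset.prod_mul_distrib, Finset.prod_mul_distrib, Finset.prod_const, Finset.prod_const,
    Finset.card_univ, Fintype.card_fin, ← hn] at hprod
  obtain ⟨P, hP⟩ : ∃ P, ∏ j, (m j - 1) = P := ⟨_, rfl⟩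
  rw [hP] at h hprod
  norm_num at hprod
  omega

/-- **`11 · (|K| − 1)⁹ ≤ Val(K⁹)`** for every finite abelian group `K`. -/
theorem soloVal_ninth_le_prattVal (K : Type*) [AddCommGroup K] [Fintype K] [DecidableEq K] :
    11 * (Fintype.card K - 1) ^ 9 ≤ prattVal (Fin 9 → K) := by
  have h := soloVal_le_prattVal_pi_of_isLocalStrongUSP (K := fun _ : Fin 9 => K)
    soloVal_isLocalStrongUSP_width9
  simpa [Finset.prod_const, Finset.card_univ, Fintype.card_fin] using h

end Summit.MatrixMultiplication.MatrixMultiplication.Theorems
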